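import Summits.CriticalPhenomena.PercolationContinuityZ3.Theorems.Transplant.BccClawXLegs
import HarnessLib

/-!
# The bcc (001)-slabs, exit-form routing certificate VI: the FRAME of an exceptional (stacked) configuration — model, kernel computation, and the
# `2 × 3` patch of columns in `Site 2`

builds on p205010 (kernel theorem, internal audit signed; external expert review pending) — NOT used in this file.
Lane `prim-bschramm`, seat `prim-bschramm-p2` (gen 46; class C1b, METHOD = input substitution; memo `HOME/bschramm/P2-LATTICES.md` §156); helper file
(`--supports stmt-CriticalPhenomena-4575 --as helper`).
The planar claw rule («BccClawXTable») does not serve the EXCEPTIONAL family `stackedExc` — `E₁, E₂` stacked in one column `a` which has exactly two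
neighbour columns in the rerouting region, one of them, `s`, carrying `w'` (`268` column patterns over the `52` clip classes) —; these are routed in 3D
(«BccSlabStackedRoute») inside the `2 × 3` patch `a, s | a+ν, s+ν | a+2ν, s+2ν` going INWARD.  This file
* §1 defines the frame test `frameOK` (`μ = s − a` and `ν` perpendicular unit vectors, the six patch columns in the rerouting region) and checks by KERNEL
  COMPUTATION (`stackOKb_all`, one `decide +kernel` over all `52` classes) that every exceptional configuration has a frame (`stackOK`);
* §2 turns it into `Site 2` geometry: `vec`, the frame columns `fcol A μ ν i j = A + i μ + j ν`, their adjacencies and distinctness (`fcol_inj`), the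
  structure **`Frame`**, and **`exists_frame_of_tgtCols`** — the frame of a column-certified exceptional triple, in the form «BccSlabClearedSetX».`ColRouting`
  presents it.
[cite: DuminilCopinSidoraviciusTassion2016, §2.3 (proof of Fact 2: the three disjoint paths in B̄_R(z))]
-/

namespace Summit.CriticalPhenomena.PercolationContinuityZ3.Theorems.Transplant

namespace BccClawX

open Literature.Probability.Percolation Literature.Probability.LatticeModels SimpleGraph

/-! ## §1 The frame of an exceptional (stacked) configuration: model and kernel computation -/

/-- The four unit vectors of `ℤ²`. [folklore] -/
def units : List Pt := [(1, 0), (-1, 0), (0, 1), (0, -1)]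

/-- Translation of a column by a vector. [folklore] -/
def padd (p q : Pt) : Pt := (p.1 + q.1, p.2 + q.2)

/-- **The frame test** of a stacked configuration `a₁ = a₂ = a`, `a₃ = s`: `μ = s − a` and `ν` are perpendicular unit vectors and the six columns
`a, a+ν, a+2ν, s, s+ν, s+2ν` (the `2 × 3` patch going INWARD from the side pair `a, s`) all lie in the rerouting region. [folklore] -/
def frameOK (tR tD sR sD : ℕ) (a s ν : Pt) : Bool :=
  units.contains (s.1 - a.1, s.2 - a.2) && units.contains ν && ((s.1 - a.1) * ν.1 + (s.2 - a.2) * ν.2 == 0) &&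
    [a, padd a ν, padd (padd a ν) ν, s, padd s ν, padd (padd s ν) ν].all (inRPp tR tD sR sD)

/-- The inward direction of the frame, found among the four unit vectors. [folklore] -/
def frameNu (tR tD sR sD : ℕ) (a s : Pt) : Option Pt := units.find? (frameOK tR tD sR sD a s)

/-- **The check for one clip class** (Boolean): every exceptional configuration (`stackedExc`, with `a₃ ≠ a₁ = a₂`) has a frame. [folklore] -/
def stackOKb (c : ℕ × ℕ × ℕ × ℕ) : Bool :=
  (tgtRList c.1 c.2.1 c.2.2.1 c.2.2.2).all fun a1 => (tgtList c.2.1 c.2.2.2).all fun a3 =>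
    !(!(a3 == a1) && stackedExc c.1 c.2.1 c.2.2.1 c.2.2.2 a1 a1 a3) || (frameNu c.1 c.2.1 c.2.2.1 c.2.2.2 a1 a3).isSome

/-- The `52` clip classes `(t_R, t_D, s_R, s_D)`: `t_R ≤ 3`, `t_R ≤ t_D ≤ 4`, `s_R ≤ 3`, `s_R ≤ s_D ≤ 4`, `t_R = 3 ∨ s_R = 3`. [folklore] -/
def classList : List (ℕ × ℕ × ℕ × ℕ) :=
  ((List.range 4).flatMap fun tR => (List.range 5).flatMap fun tD => (List.range 4).flatMap fun sR => (List.range 5).map fun sD => (tR, tD, sR, sD)).filter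
    fun c => decide (c.1 ≤ c.2.1) && decide (c.2.2.1 ≤ c.2.2.2) && (decide (c.1 = 3) || decide (c.2.2.1 = 3))

/-- **Every exceptional configuration of every clip class has a frame** (kernel computation over the `52` classes). [folklore] -/
theorem stackOKb_all : classList.all stackOKb = true := by decide +kernel

/-- The same, unfolded, for class codes given with their bounds. [folklore] -/
theorem stackOK {cR cD cS cE : ℕ} (hR : cR ≤ 3) (hD : cD ≤ 4) (hS : cS ≤ 3) (hE : cE ≤ 4) (hRD : cR ≤ cD) (hSE : cS ≤ cE) (hone : cR = 3 ∨ cS = 3)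
    {a1 a3 : Pt} (h1 : a1 ∈ tgtRList cR cD cS cE) (h3 : a3 ∈ tgtList cD cE) (hc : (!(a3 == a1) && stackedExc cR cD cS cE a1 a1 a3) = true) :
    (frameNu cR cD cS cE a1 a3).isSome = true := by
  have hmem : (cR, cD, cS, cE) ∈ classList := by
    simp only [classList, List.mem_filter, List.mem_flatMap, List.mem_map, List.mem_range, Bool.and_eq_true, Bool.or_eq_true, decide_eq_true_eq]
    exact ⟨⟨cR, by omega, cD, by omega, cS, by omega, cE, by omega, rfl⟩, ⟨hRD, hSE⟩, hone⟩
  have hb := List.all_eq_true.1 stackOKb_all _ hmem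
  simp only [stackOKb, List.all_eq_true] at hb
  have h' := hb a1 h1 a3 h3
  rw [hc] at h'
  simpa using h'

/-! ## §2 Soundness: the frame as columns of `Site 2` -/

/-- A vector of the model as a vector of `Site 2`. [folklore] -/
def vec (ν : Pt) : Site 2 := fun i => if i = 0 then ν.1 else ν.2

/-- Components of `vec`. [folklore] -/
@[simp] theorem vec_apply_zero (ν : Pt) : vec ν 0 = ν.1 := rfl

/-- Components of `vec`. [folklore] -/
@[simp] theorem vec_apply_one (ν : Pt) : vec ν 1 = ν.2 := rfl

/-- The unit vectors of the model are `± e₀, ± e₁`. [folklore] -/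
theorem vec_units : vec (1, 0) = Pi.single 0 1 ∧ vec (-1, 0) = -Pi.single 0 1 ∧ vec (0, 1) = Pi.single 1 1 ∧ vec (0, -1) = -Pi.single 1 1 := by
  refine ⟨?_, ?_, ?_, ?_⟩ <;> ext i <;> fin_cases i <;> rfl

/-- Membership in `units`. [folklore] -/
theorem mem_units_iff {ν : Pt} : ν ∈ units ↔ ν = (1, 0) ∨ ν = (-1, 0) ∨ ν = (0, 1) ∨ ν = (0, -1) := by
  simp [units]

/-- Translating by a unit vector is a lattice step. [folklore] -/
theorem adj_add_vec {ν : Pt} (hν : ν ∈ units) (w : Site 2) : (zdGraph 2).Adj w (w + vec ν) := by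
  rw [zdGraph_adj_iff]
  obtain ⟨e1, e2, e3, e4⟩ := vec_units
  rcases mem_units_iff.1 hν with rfl | rfl | rfl | rfl
  · exact ⟨0, Or.inl (by rw [e1])⟩
  · exact ⟨0, Or.inr (by rw [e2, add_assoc, neg_add_cancel, add_zero])⟩
  · exact ⟨1, Or.inl (by rw [e3])⟩
  · exact ⟨1, Or.inr (by rw [e4, add_assoc, neg_add_cancel, add_zero])⟩

/-- **The frame columns** `A + i μ + j ν` (`i ∈ {0,1}`: the side pair `a, s`; `j ∈ {0,1,2}`: inward). [folklore] -/
def fcol (A : Site 2) (μ ν : Pt) (i j : ℤ) : Site 2 := A + vec (i * μ.1 + j * ν.1, i * μ.2 + j * ν.2)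

/-- `fcol 0 0 = A`. [folklore] -/
theorem fcol_zero (A : Site 2) (μ ν : Pt) : fcol A μ ν 0 0 = A := by
  ext i; fin_cases i <;> simp [fcol]

/-- One step along `μ`. [folklore] -/
theorem fcol_succ_i (A : Site 2) (μ ν : Pt) (i j : ℤ) : fcol A μ ν (i + 1) j = fcol A μ ν i j + vec μ := by
  ext l; fin_cases l <;> simp [fcol] <;> ring

/-- One step along `ν`. [folklore] -/
theorem fcol_succ_j (A : Site 2) (μ ν : Pt) (i j : ℤ) : fcol A μ ν i (j + 1) = fcol A μ ν i j + vec ν := by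
  ext l; fin_cases l <;> simp [fcol] <;> ring

/-- **The frame columns are distinct for distinct coefficients** (perpendicular unit vectors are independent). [folklore] -/
theorem fcol_inj {A : Site 2} {μ ν : Pt} (hμ : μ ∈ units) (hν : ν ∈ units) (hperp : μ.1 * ν.1 + μ.2 * ν.2 = 0) {i j i' j' : ℤ}
    (h : fcol A μ ν i j = fcol A μ ν i' j') : i = i' ∧ j = j' := by
  have h0 := congrFun h 0
  have h1 := congrFun h 1
  simp only [fcol, Pi.add_apply, vec_apply_zero, vec_apply_one, add_right_inj] at h0 h1
  obtain ⟨m1, m2⟩ := μ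
  obtain ⟨n1, n2⟩ := ν
  simp only [mem_units_iff, Prod.mk.injEq] at hμ hν
  simp only at hperp h0 h1
  rcases hμ with ⟨rfl, rfl⟩ | ⟨rfl, rfl⟩ | ⟨rfl, rfl⟩ | ⟨rfl, rfl⟩ <;>
    rcases hν with ⟨rfl, rfl⟩ | ⟨rfl, rfl⟩ | ⟨rfl, rfl⟩ | ⟨rfl, rfl⟩ <;> simp at hperp <;> constructor <;> omega

/-- **THE FRAME of a stacked configuration, as columns of `Site 2`**: perpendicular unit vectors `μ` (along the side, `a ↦ s`) and `ν` (inward), and the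
`2 × 3` patch of columns `A + i μ + j ν` (`i ≤ 1`, `j ≤ 2`) inside the rerouting region. [folklore] -/
structure Frame (RP : Set (Site 2)) (A : Site 2) (μ ν : Pt) : Prop where
  /-- `μ` is a unit vector -/
  hμ : μ ∈ units
  /-- `ν` is a unit vector -/
  hν : ν ∈ units
  /-- perpendicular -/
  hperp : μ.1 * ν.1 + μ.2 * ν.2 = 0
  /-- the patch lies in the rerouting region -/
  hreg : ∀ i j : ℤ, 0 ≤ i → i ≤ 1 → 0 ≤ j → j ≤ 2 → fcol A μ ν i j ∈ RP

namespace Frame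

variable {RP : Set (Site 2)} {A : Site 2} {μ ν : Pt} (F : Frame RP A μ ν)
include F

/-- Adjacency along `μ`. [folklore] -/
theorem adj_i (j : ℤ) : (zdGraph 2).Adj (fcol A μ ν 0 j) (fcol A μ ν 1 j) := by
  have := adj_add_vec F.hμ (fcol A μ ν 0 j); rwa [← fcol_succ_i, zero_add] at this

/-- Adjacency along `ν`. [folklore] -/
theorem adj_j (i j : ℤ) : (zdGraph 2).Adj (fcol A μ ν i j) (fcol A μ ν i (j + 1)) := by
  have := adj_add_vec F.hν (fcol A μ ν i j); rwa [← fcol_succ_j] at this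

/-- Distinct coefficients give distinct columns. [folklore] -/
theorem ne {i j i' j' : ℤ} (h : i ≠ i' ∨ j ≠ j') : fcol A μ ν i j ≠ fcol A μ ν i' j' := by
  intro e; obtain ⟨e1, e2⟩ := fcol_inj F.hμ F.hν F.hperp e; rcases h with h | h <;> omega

end Frame

/-- **Soundness of the frame test.** [folklore] -/
theorem frame_of_frameOK {z : Site 2} {tR tD sR sD : ℕ} {a s ν : Pt} (h : frameOK (min tR 3) (min tD 4) (min sR 3) (min sD 4) a s ν = true) :
    Frame (BccSlab.Dcols z tD sD ∩ sqBlkR 3 z tR sR) (pt z a) (s.1 - a.1, s.2 - a.2) ν ∧ pt z s = fcol (pt z a) (s.1 - a.1, s.2 - a.2) ν 1 0 := by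
  simp only [frameOK, Bool.and_eq_true, List.contains_iff_mem, beq_iff_eq, List.all_cons, List.all_nil, and_true] at h
  obtain ⟨⟨⟨hμ, hν⟩, hperp⟩, hra, hru, hru', hrs, hrd, hrd'⟩ := h
  have reg : ∀ p : Pt, inRPp (min tR 3) (min tD 4) (min sR 3) (min sD 4) p = true → pt z p ∈ BccSlab.Dcols z tD sD ∩ sqBlkR 3 z tR sR := by
    intro p hp; rw [← rel_pt z p] at hp; exact inRPp_rel_iff.1 hp
  have key : ∀ (i j : ℤ) (p : Pt), p.1 = a.1 + i * (s.1 - a.1) + j * ν.1 → p.2 = a.2 + i * (s.2 - a.2) + j * ν.2 →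
      fcol (pt z a) (s.1 - a.1, s.2 - a.2) ν i j = pt z p := by
    intro i j p hp1 hp2
    ext l; fin_cases l
    · show (pt z a + vec _) 0 = pt z p 0
      rw [Pi.add_apply, pt_apply_zero, pt_apply_zero, vec_apply_zero, hp1]; ring
    · show (pt z a + vec _) 1 = pt z p 1
      rw [Pi.add_apply, pt_apply_one, pt_apply_one, vec_apply_one, hp2]; ring
  have hs : pt z s = fcol (pt z a) (s.1 - a.1, s.2 - a.2) ν 1 0 := (key 1 0 s (by ring) (by ring)).symm
  have e00 : fcol (pt z a) (s.1 - a.1, s.2 - a.2) ν 0 0 = pt z a := key 0 0 a (by ring) (by ring)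
  have e01 : fcol (pt z a) (s.1 - a.1, s.2 - a.2) ν 0 1 = pt z (padd a ν) := key 0 1 _ (by simp [padd]) (by simp [padd])
  have e02 : fcol (pt z a) (s.1 - a.1, s.2 - a.2) ν 0 2 = pt z (padd (padd a ν) ν) := key 0 2 _ (by simp [padd]; ring) (by simp [padd]; ring)
  have e11 : fcol (pt z a) (s.1 - a.1, s.2 - a.2) ν 1 1 = pt z (padd s ν) := key 1 1 _ (by simp [padd]) (by simp [padd])
  have e12 : fcol (pt z a) (s.1 - a.1, s.2 - a.2) ν 1 2 = pt z (padd (padd s ν) ν) := key 1 2 _ (by simp [padd]; ring) (by simp [padd]; ring)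
  refine ⟨⟨hμ, hν, hperp, fun i j hi0 hi1 hj0 hj2 => ?_⟩, hs⟩
  interval_cases i <;> interval_cases j
  · rw [e00]; exact reg a hra
  · rw [e01]; exact reg _ hru
  · rw [e02]; exact reg _ hru'
  · rw [← hs]; exact reg s hrs
  · rw [e11]; exact reg _ hrd
  · rw [e12]; exact reg _ hrd'

/-- **THE FRAME EXISTS for a column-certified exceptional triple** (tree form): if the common column `a₁` of `E₁, E₂` and the column `a₃` of `w'` are target
columns and the configuration is exceptional, there is a frame `(a₁; μ, ν)` in the rerouting region with `a₃ = a₁ + μ`. [folklore] -/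
theorem exists_frame_of_tgtCols {z : Site 2} {tR tD sR sD : ℕ} (hRD : tR ≤ tD) (hSE : sR ≤ sD) (hone : 3 ≤ tR ∨ 3 ≤ sR) {a₁ a₃ : Site 2}
    (h1 : a₁ ∈ BccSlab.tgtCols z tD sD) (h1R : a₁ ∈ sqBlkR 3 z tR sR) (h1z : a₁ ≠ z) (h3 : a₃ ∈ BccSlab.tgtCols z tD sD) (h3z : a₃ ≠ z) (h31 : a₃ ≠ a₁)
    (hexc : stackedExc (min tR 3) (min tD 4) (min sR 3) (min sD 4) (rel z a₁) (rel z a₁) (rel z a₃) = true) :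
    ∃ μ ν : Pt, Frame (BccSlab.Dcols z tD sD ∩ sqBlkR 3 z tR sR) a₁ μ ν ∧ a₃ = fcol a₁ μ ν 1 0 := by
  obtain ⟨cR, cD, cS, cE, cRD, cSE, cone⟩ := codes_ok hRD hSE hone
  have hne : rel z a₃ ≠ rel z a₁ := fun h => h31 (by rw [← pt_rel z a₃, h, pt_rel])
  have hcond : (!(rel z a₃ == rel z a₁) && stackedExc (min tR 3) (min tD 4) (min sR 3) (min sD 4) (rel z a₁) (rel z a₁) (rel z a₃)) = true := by
    rw [Bool.and_eq_true, hexc]; simpa using hne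
  have := stackOK cR cD cS cE cRD cSE cone (mem_tgtRList h1 h1R h1z) (mem_tgtList h3 h3z) hcond
  obtain ⟨ν, hν⟩ := Option.isSome_iff_exists.1 this
  have hok := List.find?_some hν
  obtain ⟨hF, hs⟩ := frame_of_frameOK (z := z) hok
  rw [pt_rel, pt_rel] at hs
  rw [pt_rel] at hF
  exact ⟨_, ν, hF, hs⟩

end BccClawX

end Summit.CriticalPhenomena.PercolationContinuityZ3.Theorems.Transplant
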